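import Literature.NumberTheory.Automorphic.UnitaryLatticeTreeEulerRelation   -- ★ root star = `K₀·N₁`, `N_x` membership (`exists_mem_neighborSet_root_forall_mem_iff`, `eq_of_forall_mem_iff`)
import Literature.NumberTheory.Automorphic.UnitaryLatticeTreeFixedStar       -- ★ fixed-star test `latticeGraphIso_N₁_eq_iff`, ★ `firstColumn_props`, ★ `mem_mapGL_N₁_iff` (via T1d-C1)
import HarnessLib

/-!
# R90 · S6 «Ch. 14.1–14.5 stable trace formula» — card W8-i″, FILE 3c-B (RESIDUAL VALUE «PLANE-UNIPOTENT ⊕ SEPARATED LINE»): a `k ∈ K₀` which in an integral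
# frame is residually `c₁·(unipotent ≠ 1)` on a plane and a SEPARATED scalar on the complementary anisotropic line fixes EXACTLY ONE special neighbour of the root
# (`Theorems/R90S6ResidualStarFixedPlaneUnipotent.lean`)

Cell `hodgecm-mathlib`, crux H413 (`stmt-HodgeConjecture-24833`), route of record `HCCMUnconditional`; programme R90-TF, section S6 (base `R90-C14`), seat R90-C14-p05 (g0);
S6 dealer R90-C14-plan (g2) 00:29:12Z «p05 … DOES 3c (two congruent eigenvalues) NEXT because TYPE (1) needs it (`χ_t ≡ (X − c₁)²(X − c₂)`, `c̄₁ ≠ c̄₂`: `k_x` residually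
{scalar-on-a-plane ⊕ c₂} or {unipotent-on-the-plane ⊕ c₂})» (DAG r5 row E1.3.5.2.4).  This file is the second alternative; the first (value `q+1`) is FILE 3c-A.  Helper lane
`--supports stmt-HodgeConjecture-24833 --as helper`; ONE theorem (no definition, no instance, no notation, no named fact, no `sorry`); imports = ★ `UnitaryLatticeTreeEulerRelation`
+ ★ `UnitaryLatticeTreeFixedStar` + HarnessLib.

THE MATHEMATICS [Wilson2009, §3.6.1; BruhatTits1972, §10; Tits1979, §3.5].  Unramified datum `hd`, `U = U(σ, J₀)(K)`, `K₀ = U ∩ GL₃(𝒪)`, `L₀ = 𝒪³`, star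
`= {κ·N₁} = {N_x | x primitive isotropic}`.  Let `k ∈ K₀` have an integral frame `P` (`P`, `P⁻¹` integral, `p_i = P e_i`) in which `A = P⁻¹kP` is residually
`!![c₁,0,0; *,c₁,0; 0,0,a₂₂]` with `|c₁| = 1`, `A₁₀` a UNIT (residual `c₁·(1 + unit·E₁₀)` on the plane `⟨p₀,p₁⟩`), `|A₂₂ − c₁| = 1` (separated third eigenvalue),
`|B₀(p₂,p₂)| = 1` and `|B₀(p₁,p₁)| < 1` (the image line of the residual nilpotent is isotropic — automatic for unitary `k`, kept as a hypothesis so the file stays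
form-algebra-free): the residual type «unipotent-on-the-plane ⊕ c₂» of the local monodromy of a type-(1) torus element with two residually congruent eigenvalues.
Then `k` fixes EXACTLY ONE star vertex, `N_{p₁}`: (i) `kp₁ ≡ c₁p₁` gives `N_{p₁}` fixed (`B₀(p₁, k⁻¹y) = B₀(kp₁, y)`); (ii) for a fixed `N_x` (`x = κe₀`, ★
`firstColumn_props`, `kx ≡ c′x` by ★ `latticeGraphIso_N₁_eq_iff`) the frame coordinates `y = P⁻¹x` satisfy `Ay ≡ c′y`; `|y₂| = 1` would force `|c′ − c₁| = 1`,
`y₀, y₁ ∈ 𝔪`, `x ≡ y₂p₂` anisotropic — impossible; `|y₀| = 1` would force `c′ ≡ c₁` and `|A₁₀y₀| < 1` — impossible; so `|y₁| = 1`, `x ≡ y₁p₁`, `N_x = N_{p₁}`.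
**`{w ∈ star(L₀) | k·w = w} = {N_{p₁}}`, `ncard = 1`.**  Pure valuation algebra: no residue field, no finiteness.
HONEST LABEL: lattice ∕ valuation bookkeeping over ★ organs; count-neutral until the per-literal censuses (S1, type (1)) + W8-f consume it; proves no printed statement.  HC_CM is
proved only modulo the 7 printed citations (2 remaining named inputs: hLiu418 = stmt-HodgeConjecture-24832, h413 = stmt-HodgeConjecture-24833) until rung 0 closes.
-/

set_option autoImplicit false
-- the mandated namespace repeats the single-problem summit's segment (`HodgeConjecture.HodgeConjecture`)
set_option linter.dupNamespace false

noncomputable section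

open Literature.NumberTheory.Automorphic Literature.NumberTheory.Automorphic.HermitianLattice Literature.NumberTheory.Automorphic.UnitaryGroup
open Literature.NumberTheory.Automorphic.UnitaryLatticeTree Literature.NumberTheory.Automorphic.CartanUnique
open scoped Matrix MatrixGroups WithZero Valued

namespace Summit.HodgeConjecture.HodgeConjecture.R90.S6

/-- **W8-i″ FILE 3c-B — «RESIDUALLY `c₁`·UNIPOTENT ON A PLANE ⊕ A SEPARATED LINE» FIXES EXACTLY ONE VERTEX OF THE STAR OF THE ROOT.**  For an unramified datum `hd`,
`k ∈ K₀`, a frame `P ∈ GL₃(K)` with `P`, `P⁻¹` integral such that `A = P⁻¹kP` has `|A₀₀ − c₁|, |A₁₁ − c₁| < 1`, `|A₁₀| = 1`, `|A₂₂ − c₁| = 1`, all other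
off-diagonal entries in `𝔪` (`|c₁| = 1`), with `|B₀(Pe₂, Pe₂)| = 1` and `|B₀(Pe₁, Pe₁)| < 1`: the `k`-fixed vertices of the star of `L₀ = 𝒪³` in ★ `latticeGraph σ ϖ J₀`
form the singleton `{N_{Pe₁}}`, so the count of ★ FILE 2 is `1`. [cite: Wilson2009, §3.6.1] [cite: BruhatTits1972, §10] [cite: Tits1979, §3.5] -/
theorem ncard_fixed_neighborSet_root_eq_one_of_residually_plane_unipotent {K : Type*} [Field K] [Valued K ℤᵐ⁰]
    {σ : K →+* K} {ϖ : K} (hd : UnramifiedLocalConjDatum σ ϖ)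
    (k : ↥(unitaryGroupOfForm σ ((StdForm.antidiagonal 3).over K))) (hk : k ∈ unitaryInt σ ((StdForm.antidiagonal 3).over K))
    (P : GL (Fin 3) K) (hP : ∀ i j, Valued.v ((P : Matrix (Fin 3) (Fin 3) K) i j) ≤ 1) (hP' : ∀ i j, Valued.v (((P⁻¹ : GL (Fin 3) K) : Matrix (Fin 3) (Fin 3) K) i j) ≤ 1)
    {c₁ : K} (hc₁ : Valued.v c₁ = 1)
    (h00 : Valued.v ((((P⁻¹ : GL (Fin 3) K) : Matrix (Fin 3) (Fin 3) K) * ((k : GL (Fin 3) K) : Matrix (Fin 3) (Fin 3) K) * (P : Matrix (Fin 3) (Fin 3) K)) 0 0 - c₁) < 1)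
    (h11 : Valued.v ((((P⁻¹ : GL (Fin 3) K) : Matrix (Fin 3) (Fin 3) K) * ((k : GL (Fin 3) K) : Matrix (Fin 3) (Fin 3) K) * (P : Matrix (Fin 3) (Fin 3) K)) 1 1 - c₁) < 1)
    (h22 : Valued.v ((((P⁻¹ : GL (Fin 3) K) : Matrix (Fin 3) (Fin 3) K) * ((k : GL (Fin 3) K) : Matrix (Fin 3) (Fin 3) K) * (P : Matrix (Fin 3) (Fin 3) K)) 2 2 - c₁) = 1)
    (h10 : Valued.v ((((P⁻¹ : GL (Fin 3) K) : Matrix (Fin 3) (Fin 3) K) * ((k : GL (Fin 3) K) : Matrix (Fin 3) (Fin 3) K) * (P : Matrix (Fin 3) (Fin 3) K)) 1 0) = 1)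
    (hoff : ∀ i j : Fin 3, i ≠ j → (i, j) ≠ ((1 : Fin 3), (0 : Fin 3)) →
      Valued.v ((((P⁻¹ : GL (Fin 3) K) : Matrix (Fin 3) (Fin 3) K) * ((k : GL (Fin 3) K) : Matrix (Fin 3) (Fin 3) K) * (P : Matrix (Fin 3) (Fin 3) K)) i j) < 1)
    (hp1 : Valued.v (B₀ σ 3 ((P : Matrix (Fin 3) (Fin 3) K).mulVec (Pi.single 1 1)) ((P : Matrix (Fin 3) (Fin 3) K).mulVec (Pi.single 1 1))) < 1)
    (hp2 : Valued.v (B₀ σ 3 ((P : Matrix (Fin 3) (Fin 3) K).mulVec (Pi.single 2 1)) ((P : Matrix (Fin 3) (Fin 3) K).mulVec (Pi.single 2 1))) = 1) :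
    {w : {M : Submodule 𝒪[K] (Fin 3 → K) // IsVertex σ ϖ ((StdForm.antidiagonal 3).over K) M} |
        w ∈ (latticeGraph σ ϖ ((StdForm.antidiagonal 3).over K)).neighborSet ⟨stdLattice K 3, 0, isSelfDualLattice_stdLattice_three hd⟩ ∧
          latticeGraphIso σ ϖ ((StdForm.antidiagonal 3).over K) k w = w}.ncard = 1 := by
  classical
  have hϖ0 : ϖ ≠ 0 := uniformizer_ne_zero hd.vϖ
  have hϖ1 : Valued.v ϖ ≤ 1 := uniformizer_mem_integer hd.vϖ
  have hlt1 : ∀ z : K, Valued.v z < 1 ↔ Valued.v z ≤ Valued.v ϖ := fun z => by rw [hd.vϖ]; exact v_lt_one_iff z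
  set kM : Matrix (Fin 3) (Fin 3) K := ((k : GL (Fin 3) K) : Matrix (Fin 3) (Fin 3) K) with hkM
  set PM : Matrix (Fin 3) (Fin 3) K := (P : Matrix (Fin 3) (Fin 3) K) with hPM
  set QM : Matrix (Fin 3) (Fin 3) K := ((P⁻¹ : GL (Fin 3) K) : Matrix (Fin 3) (Fin 3) K) with hQM
  set A : Matrix (Fin 3) (Fin 3) K := QM * kM * PM with hA
  have hPQ : PM * QM = 1 := by rw [hPM, hQM, ← Units.val_mul, mul_inv_cancel, Units.val_one]
  have hQP : QM * PM = 1 := by rw [hPM, hQM, ← Units.val_mul, inv_mul_cancel, Units.val_one]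
  have hkint : ∀ i j, Valued.v (kM i j) ≤ 1 := (mem_unitaryInt_iff.1 hk).1
  have hQk : ∀ i j, Valued.v ((QM * kM) i j) ≤ 1 := fun i j => by
    rw [Matrix.mul_apply]
    refine Valuation.map_sum_le _ fun a _ => ?_
    rw [map_mul]; exact mul_le_one' (hP' i a) (hkint a j)
  have hAint : ∀ i j, Valued.v (A i j) ≤ 1 := fun i j => by
    rw [hA, Matrix.mul_apply]
    refine Valuation.map_sum_le _ fun a _ => ?_
    rw [map_mul]; exact mul_le_one' (hQk i a) (hP a j)
  -- the frame columns `p₁`, `p₂` (opaque) and their integrality ∕ primitivity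
  obtain ⟨p₁, hp₁⟩ : ∃ p : Fin 3 → K, p = PM.mulVec (Pi.single 1 1) := ⟨_, rfl⟩
  obtain ⟨p₂, hp₂⟩ : ∃ p : Fin 3 → K, p = PM.mulVec (Pi.single 2 1) := ⟨_, rfl⟩
  rw [← hp₁] at hp1
  rw [← hp₂] at hp2
  have hpcol : ∀ (j i : Fin 3), (PM.mulVec (Pi.single j 1)) i = PM i j := fun j i => by rw [Matrix.mulVec_single_one]; rfl
  have hp₁int : p₁ ∈ stdLattice K 3 := by rw [hp₁]; exact mulVec_mem_stdLattice_of_forall_v_le_one hP (single_mem_stdLattice 1)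
  have hp₂int : ∀ i, Valued.v (p₂ i) ≤ 1 := by rw [hp₂]; exact mulVec_mem_stdLattice_of_forall_v_le_one hP (single_mem_stdLattice 2)
  have hp₁unit : ∃ j, Valued.v (p₁ j) = 1 := by
    by_contra hne
    push Not at hne
    have hlt : ∀ a, Valued.v (p₁ a) < 1 := fun a => lt_of_le_of_ne (hp₁int a) (hne a)
    have h1 : (QM.mulVec p₁) 1 = 1 := by
      rw [hp₁, Matrix.mulVec_mulVec, hQP, Matrix.one_mulVec, Pi.single_eq_same]
    have hlt1' : Valued.v ((QM.mulVec p₁) 1) < 1 := by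
      change Valued.v (∑ a, QM 1 a * p₁ a) < 1
      refine Valuation.map_sum_lt _ one_ne_zero fun a _ => ?_
      rw [map_mul]
      calc Valued.v (QM 1 a) * Valued.v (p₁ a) ≤ 1 * Valued.v (p₁ a) := mul_le_mul' (hP' 1 a) le_rfl
        _ < 1 := by rw [one_mul]; exact hlt a
    rw [h1, map_one] at hlt1'
    exact lt_irrefl _ hlt1'
  -- `k p₁ ≡ c₁ p₁ (mod 𝔪)`: `k p₁ − c₁ p₁ = P((A − c₁)e₁)` and column 1 of `A − c₁·1` is in `𝔪`
  have hkp₁ : ∀ i, Valued.v ((kM.mulVec p₁ - c₁ • p₁) i) < 1 := by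
    have e : kM.mulVec p₁ - c₁ • p₁ = PM.mulVec (A.mulVec (Pi.single 1 1) - c₁ • Pi.single 1 1) := by
      rw [Matrix.mulVec_sub, Matrix.mulVec_smul, Matrix.mulVec_mulVec, hA, ← Matrix.mul_assoc, ← Matrix.mul_assoc, hPQ, Matrix.one_mul,
        ← Matrix.mulVec_mulVec, ← hp₁]
    intro i
    rw [e]
    change Valued.v (∑ a, PM i a * (A.mulVec (Pi.single 1 1) - c₁ • (Pi.single 1 1 : Fin 3 → K)) a) < 1
    refine Valuation.map_sum_lt _ one_ne_zero fun a _ => ?_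
    rw [map_mul]
    have hsmall : Valued.v ((A.mulVec (Pi.single 1 1) - c₁ • (Pi.single 1 1 : Fin 3 → K)) a) < 1 := by
      rw [Pi.sub_apply, Pi.smul_apply, smul_eq_mul, Matrix.mulVec_single_one]
      change Valued.v (A a 1 - c₁ * (Pi.single 1 1 : Fin 3 → K) a) < 1
      by_cases ha : a = 1
      · subst ha; rw [Pi.single_eq_same, mul_one]; exact h11
      · rw [Pi.single_eq_of_ne ha, mul_zero, sub_zero]
        exact hoff a 1 ha (by intro h; simp only [Prod.mk.injEq] at h; exact absurd h.2 (by decide))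
    calc Valued.v (PM i a) * Valued.v ((A.mulVec (Pi.single 1 1) - c₁ • (Pi.single 1 1 : Fin 3 → K)) a) ≤
        1 * Valued.v ((A.mulVec (Pi.single 1 1) - c₁ • (Pi.single 1 1 : Fin 3 → K)) a) := mul_le_mul' (hP i a) le_rfl
      _ < 1 := by rw [one_mul]; exact hsmall
  -- `|B₀ (k p₁) y − σ(c₁) B₀ p₁ y| < 1` for integral `y`
  have hBkp₁ : ∀ y : Fin 3 → K, y ∈ stdLattice K 3 → Valued.v (B₀ σ 3 (kM.mulVec p₁) y - σ c₁ * B₀ σ 3 p₁ y) < 1 := by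
    intro y hy
    have e : B₀ σ 3 (kM.mulVec p₁) y - σ c₁ * B₀ σ 3 p₁ y = B₀ σ 3 (kM.mulVec p₁ - c₁ • p₁) y := by
      rw [map_sub, LinearMap.sub_apply, LinearMap.map_smulₛₗ, LinearMap.smul_apply, smul_eq_mul]
    rw [e, B₀_apply]
    refine Valuation.map_sum_lt _ one_ne_zero fun a _ => ?_
    rw [map_mul, hd.vσ]
    calc Valued.v ((kM.mulVec p₁ - c₁ • p₁) a) * Valued.v (y (Fin.rev a)) ≤ Valued.v ((kM.mulVec p₁ - c₁ • p₁) a) * 1 := mul_le_mul' le_rfl (hy _)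
      _ < 1 := by rw [mul_one]; exact hkp₁ a
  -- the candidate fixed vertex `W₁ = N_{p₁}`
  obtain ⟨W₁, hW₁, hW₁mem⟩ := exists_mem_neighborSet_root_forall_mem_iff hd hp₁int hp₁unit hp1
  -- (i) `W₁` is fixed
  have hW₁fix : latticeGraphIso σ ϖ ((StdForm.antidiagonal 3).over K) k W₁ = W₁ := by
    rw [latticeGraphIso_apply_eq_self_iff]
    apply SetLike.ext
    intro y
    rw [mem_mapGL_iff, hW₁mem, hW₁mem, ← Subgroup.coe_inv, ← B₀_mulVec_eq_B₀_inv_mulVec]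
    have hkz : kM.mulVec ((((k⁻¹ : ↥(unitaryGroupOfForm σ ((StdForm.antidiagonal 3).over K))) : GL (Fin 3) K) : Matrix (Fin 3) (Fin 3) K).mulVec y) = y := by
      rw [Matrix.mulVec_mulVec, hkM, Subgroup.coe_inv, ← Units.val_mul, mul_inv_cancel, Units.val_one, Matrix.one_mulVec]
    constructor
    · rintro ⟨hz, hB⟩
      have hy : y ∈ stdLattice K 3 := by rw [← hkz]; exact mulVec_mem_stdLattice_of_mem_unitaryInt hk hz
      refine ⟨hy, ?_⟩
      have h := hBkp₁ y hy
      have e : σ c₁ * B₀ σ 3 p₁ y = B₀ σ 3 (kM.mulVec p₁) y - (B₀ σ 3 (kM.mulVec p₁) y - σ c₁ * B₀ σ 3 p₁ y) := by ring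
      have h' : Valued.v (σ c₁ * B₀ σ 3 p₁ y) < 1 := by rw [e]; exact Valuation.map_sub_lt _ hB h
      rwa [map_mul, hd.vσ, hc₁, one_mul] at h'
    · rintro ⟨hy, hB⟩
      refine ⟨mulVec_mem_stdLattice_of_mem_unitaryInt_inv hk hy, ?_⟩
      have h := hBkp₁ y hy
      have e : B₀ σ 3 (kM.mulVec p₁) y = (B₀ σ 3 (kM.mulVec p₁) y - σ c₁ * B₀ σ 3 p₁ y) + σ c₁ * B₀ σ 3 p₁ y := by ring
      rw [e]
      refine Valuation.map_add_lt _ h ?_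
      rw [map_mul, hd.vσ, hc₁, one_mul]; exact hB
  -- (ii) every fixed vertex of the star is `W₁`
  have huniq : ∀ w : {M : Submodule 𝒪[K] (Fin 3 → K) // IsVertex σ ϖ ((StdForm.antidiagonal 3).over K) M},
      w ∈ (latticeGraph σ ϖ ((StdForm.antidiagonal 3).over K)).neighborSet ⟨stdLattice K 3, 0, isSelfDualLattice_stdLattice_three hd⟩ →
      latticeGraphIso σ ϖ ((StdForm.antidiagonal 3).over K) k w = w → w = W₁ := by
    intro w hw hfix
    obtain ⟨κ, hκ, hw1⟩ := (mem_neighborSet_root_iff_exists_mem_unitaryInt hd w).1 hw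
    obtain ⟨c', hc', hcol⟩ := (latticeGraphIso_N₁_eq_iff hd.vσ hd.vϖ hk hκ w hw1).1 hfix
    set κM : Matrix (Fin 3) (Fin 3) K := ((κ : GL (Fin 3) K) : Matrix (Fin 3) (Fin 3) K) with hκM
    obtain ⟨x, hx⟩ : ∃ x : Fin 3 → K, x = κM.mulVec (Pi.single 0 1) := ⟨_, rfl⟩
    obtain ⟨hxint, hxiso, i₀, hxi₀⟩ := firstColumn_props hκ
    rw [← hκM, ← hx] at hxint hxiso hxi₀
    have hxcol : ∀ i, x i = κM i 0 := fun i => by rw [hx, Matrix.mulVec_single_one]; rfl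
    have hcol' : ∀ i, Valued.v ((kM.mulVec x - c' • x) i) < 1 := by
      intro i
      have e : (kM.mulVec x - c' • x) i = (kM * κM) i 0 - c' * κM i 0 := by
        rw [Pi.sub_apply, Pi.smul_apply, smul_eq_mul, hxcol, Matrix.mul_apply]
        simp only [Matrix.mulVec, dotProduct, hxcol]
      rw [e]
      exact hcol i
    -- frame coordinates `y = P⁻¹x` with `A y ≡ c′ y`
    obtain ⟨y, hy⟩ : ∃ y : Fin 3 → K, y = QM.mulVec x := ⟨_, rfl⟩
    have hPy : PM.mulVec y = x := by rw [hy, Matrix.mulVec_mulVec, hPQ, Matrix.one_mulVec]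
    have hyint : ∀ i, Valued.v (y i) ≤ 1 := by rw [hy]; exact mulVec_mem_stdLattice_of_forall_v_le_one hP' hxint
    have hAy : ∀ i, Valued.v ((A.mulVec y - c' • y) i) < 1 := by
      have e : A.mulVec y - c' • y = QM.mulVec (kM.mulVec x - c' • x) := by
        rw [Matrix.mulVec_sub, Matrix.mulVec_smul, ← hy, hA, ← Matrix.mulVec_mulVec, ← Matrix.mulVec_mulVec, hPy]
      intro i
      rw [e]
      change Valued.v (∑ j, QM i j * (kM.mulVec x - c' • x) j) < 1
      refine Valuation.map_sum_lt _ one_ne_zero fun j _ => ?_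
      rw [map_mul]
      calc Valued.v (QM i j) * Valued.v ((kM.mulVec x - c' • x) j) ≤ 1 * Valued.v ((kM.mulVec x - c' • x) j) := mul_le_mul' (hP' i j) le_rfl
        _ < 1 := by rw [one_mul]; exact hcol' j
    -- the three rows of `A y − c′ y`
    have hrow : ∀ i, (A.mulVec y - c' • y) i = (A i i - c') * y i + ∑ j ∈ Finset.univ.erase i, A i j * y j := by
      intro i
      rw [Pi.sub_apply, Pi.smul_apply, smul_eq_mul]
      change (∑ j, A i j * y j) - c' * y i = _
      rw [← Finset.add_sum_erase _ _ (Finset.mem_univ i)]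
      ring
    have hrest : ∀ i, (∀ j, j ≠ i → Valued.v (A i j * y j) < 1) → Valued.v (∑ j ∈ Finset.univ.erase i, A i j * y j) < 1 := fun i h =>
      Valuation.map_sum_lt _ one_ne_zero fun j hj => h j (Finset.ne_of_mem_erase hj)
    have hdiagterm : ∀ i, (∀ j, j ≠ i → Valued.v (A i j * y j) < 1) → Valued.v ((A i i - c') * y i) < 1 := by
      intro i h
      have e : (A i i - c') * y i = (A.mulVec y - c' • y) i - ∑ j ∈ Finset.univ.erase i, A i j * y j := by rw [hrow i]; ring
      rw [e]
      exact Valuation.map_sub_lt _ (hAy i) (hrest i h)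
    have hsmallprod : ∀ i j, Valued.v (A i j) < 1 → Valued.v (A i j * y j) < 1 := fun i j h => by
      rw [map_mul]
      calc Valued.v (A i j) * Valued.v (y j) ≤ Valued.v (A i j) * 1 := mul_le_mul' le_rfl (hyint j)
        _ < 1 := by rw [mul_one]; exact h
    have hd0 : Valued.v ((A 0 0 - c') * y 0) < 1 :=
      hdiagterm 0 fun j hj => hsmallprod 0 j (hoff 0 j (Ne.symm hj) (by intro h; simp only [Prod.mk.injEq] at h; exact absurd h.1 (by decide)))
    have hd2 : Valued.v ((A 2 2 - c') * y 2) < 1 :=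
      hdiagterm 2 fun j hj => hsmallprod 2 j (hoff 2 j (Ne.symm hj) (by intro h; simp only [Prod.mk.injEq] at h; exact absurd h.1 (by decide)))
    -- STEP 1: `y₂ ∈ 𝔪`
    have hy2 : Valued.v (y 2) < 1 := by
      by_contra hge
      have hy2' : Valued.v (y 2) = 1 := le_antisymm (hyint 2) (not_lt.1 hge)
      have hA2c : Valued.v (A 2 2 - c') < 1 := by have h := hd2; rwa [map_mul, hy2', mul_one] at h
      have hc1c : Valued.v (c₁ - c') = 1 := by
        have e : c₁ - c' = -(A 2 2 - c₁) + (A 2 2 - c') := by ring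
        have hlt : Valued.v (A 2 2 - c') < Valued.v (-(A 2 2 - c₁)) := by rw [Valuation.map_neg, h22]; exact hA2c
        rw [e, Valuation.map_add_eq_of_lt_left _ hlt, Valuation.map_neg, h22]
      have hA0c : Valued.v (A 0 0 - c') = 1 := by
        have e : A 0 0 - c' = (c₁ - c') + (A 0 0 - c₁) := by ring
        rw [e, Valuation.map_add_eq_of_lt_left _ (by rw [hc1c]; exact h00), hc1c]
      have hy0 : Valued.v (y 0) < 1 := by have h := hd0; rwa [map_mul, hA0c, one_mul] at h
      have hA1c : Valued.v (A 1 1 - c') = 1 := by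
        have e : A 1 1 - c' = (c₁ - c') + (A 1 1 - c₁) := by ring
        rw [e, Valuation.map_add_eq_of_lt_left _ (by rw [hc1c]; exact h11), hc1c]
      have hd1 : Valued.v ((A 1 1 - c') * y 1) < 1 := by
        refine hdiagterm 1 fun j hj => ?_
        fin_cases j
        · rw [map_mul]
          calc Valued.v (A 1 0) * Valued.v (y 0) ≤ 1 * Valued.v (y 0) := mul_le_mul' (hAint 1 0) le_rfl
            _ < 1 := by rw [one_mul]; exact hy0
        · exact absurd rfl hj
        · exact hsmallprod 1 2 (hoff 1 2 (by decide) (by decide))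
      have hy1 : Valued.v (y 1) < 1 := by have h := hd1; rwa [map_mul, hA1c, one_mul] at h
      -- `x = y₂ p₂ + r`, `r ∈ 𝔪³`, so `|B₀(x,x)| = 1`: contradiction with `B₀(x,x) = 0`
      obtain ⟨r, hr⟩ : ∃ r : Fin 3 → K, r = PM.mulVec (y - Pi.single 2 (y 2)) := ⟨_, rfl⟩
      have hxdec : x = y 2 • p₂ + r := by
        rw [← hPy, hp₂, hr, ← Matrix.mulVec_smul, ← Matrix.mulVec_add]
        congr 1
        funext a
        rw [Pi.add_apply, Pi.smul_apply, Pi.sub_apply, smul_eq_mul]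
        by_cases ha : a = 2
        · subst ha; rw [Pi.single_eq_same, Pi.single_eq_same]; ring
        · rw [Pi.single_eq_of_ne ha, Pi.single_eq_of_ne ha]; ring
      have hrlt : ∀ i, Valued.v (r i) < 1 := by
        intro i
        rw [hr]
        change Valued.v (∑ a, PM i a * (y - (Pi.single 2 (y 2) : Fin 3 → K)) a) < 1
        refine Valuation.map_sum_lt _ one_ne_zero fun a _ => ?_
        rw [map_mul]
        have hsmall : Valued.v ((y - (Pi.single 2 (y 2) : Fin 3 → K)) a) < 1 := by
          rw [Pi.sub_apply]
          by_cases ha : a = 2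
          · subst ha; rw [Pi.single_eq_same, sub_self, map_zero]; exact zero_lt_one
          · rw [Pi.single_eq_of_ne ha, sub_zero]
            fin_cases a
            · exact hy0
            · exact hy1
            · exact absurd rfl ha
        calc Valued.v (PM i a) * Valued.v ((y - (Pi.single 2 (y 2) : Fin 3 → K)) a) ≤ 1 * Valued.v ((y - (Pi.single 2 (y 2) : Fin 3 → K)) a) := mul_le_mul' (hP i a) le_rfl
          _ < 1 := by rw [one_mul]; exact hsmall
      have hBpx : B₀ σ 3 p₂ x = y 2 * B₀ σ 3 p₂ p₂ + B₀ σ 3 p₂ r := by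
        conv_lhs => rw [hxdec]
        rw [map_add, map_smul, smul_eq_mul]
      have hB : B₀ σ 3 x x = σ (y 2) * y 2 * B₀ σ 3 p₂ p₂ + (σ (y 2) * B₀ σ 3 p₂ r + B₀ σ 3 r x) := by
        calc B₀ σ 3 x x = B₀ σ 3 (y 2 • p₂ + r) x := by rw [← hxdec]
          _ = σ (y 2) * B₀ σ 3 p₂ x + B₀ σ 3 r x := by
              rw [map_add, LinearMap.add_apply, LinearMap.map_smulₛₗ, LinearMap.smul_apply, smul_eq_mul]
          _ = σ (y 2) * y 2 * B₀ σ 3 p₂ p₂ + (σ (y 2) * B₀ σ 3 p₂ r + B₀ σ 3 r x) := by rw [hBpx]; ring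
      have hhead : Valued.v (σ (y 2) * y 2 * B₀ σ 3 p₂ p₂) = 1 := by
        rw [map_mul, map_mul, hd.vσ, hy2', one_mul, one_mul, hp2]
      have htail : Valued.v (σ (y 2) * B₀ σ 3 p₂ r + B₀ σ 3 r x) < 1 := by
        refine Valuation.map_add_lt _ ?_ ?_
        · rw [map_mul, hd.vσ, hy2', one_mul, B₀_apply]
          refine Valuation.map_sum_lt _ one_ne_zero fun a _ => ?_
          rw [map_mul, hd.vσ]
          calc Valued.v (p₂ a) * Valued.v (r (Fin.rev a)) ≤ 1 * Valued.v (r (Fin.rev a)) := mul_le_mul' (hp₂int a) le_rfl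
            _ < 1 := by rw [one_mul]; exact hrlt _
        · rw [B₀_apply]
          refine Valuation.map_sum_lt _ one_ne_zero fun a _ => ?_
          rw [map_mul, hd.vσ]
          calc Valued.v (r a) * Valued.v (x (Fin.rev a)) ≤ Valued.v (r a) * 1 := mul_le_mul' le_rfl (hxint _)
            _ < 1 := by rw [mul_one]; exact hrlt a
      have hv : Valued.v (B₀ σ 3 x x) = 1 := by
        rw [hB, Valuation.map_add_eq_of_lt_left _ (by rw [hhead]; exact htail), hhead]
      rw [hxiso, map_zero] at hv
      exact zero_ne_one hv
    -- STEP 2: `y₀ ∈ 𝔪` (else `c′ ≡ c₁` and the unit `A₁₀ y₀` survives in row 1)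
    have hy0 : Valued.v (y 0) < 1 := by
      by_contra hge
      have hy0' : Valued.v (y 0) = 1 := le_antisymm (hyint 0) (not_lt.1 hge)
      have hA0c : Valued.v (A 0 0 - c') < 1 := by have h := hd0; rwa [map_mul, hy0', mul_one] at h
      have hc1c : Valued.v (c₁ - c') < 1 := by
        have e : c₁ - c' = (A 0 0 - c') - (A 0 0 - c₁) := by ring
        rw [e]; exact Valuation.map_sub_lt _ hA0c h00
      have hA1c : Valued.v (A 1 1 - c') < 1 := by
        have e : A 1 1 - c' = (A 1 1 - c₁) + (c₁ - c') := by ring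
        rw [e]; exact Valuation.map_add_lt _ h11 hc1c
      have e : A 1 0 * y 0 = (A.mulVec y - c' • y) 1 - ((A 1 1 - c') * y 1 + A 1 2 * y 2) := by
        rw [Pi.sub_apply, Pi.smul_apply, smul_eq_mul]
        change A 1 0 * y 0 = (∑ j, A 1 j * y j) - c' * y 1 - _
        rw [Fin.sum_univ_three]; ring
      have hsm : Valued.v ((A 1 1 - c') * y 1 + A 1 2 * y 2) < 1 := by
        refine Valuation.map_add_lt _ ?_ (hsmallprod 1 2 (hoff 1 2 (by decide) (by decide)))
        rw [map_mul]
        calc Valued.v (A 1 1 - c') * Valued.v (y 1) ≤ Valued.v (A 1 1 - c') * 1 := mul_le_mul' le_rfl (hyint 1)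
          _ < 1 := by rw [mul_one]; exact hA1c
      have h : Valued.v (A 1 0 * y 0) < 1 := by rw [e]; exact Valuation.map_sub_lt _ (hAy 1) hsm
      rw [map_mul, h10, hy0', mul_one] at h
      exact lt_irrefl _ h
    -- STEP 3: `|y₁| = 1`
    have hy1 : Valued.v (y 1) = 1 := by
      by_contra hne
      have hy1lt : Valued.v (y 1) < 1 := lt_of_le_of_ne (hyint 1) hne
      have hlt : ∀ a, Valued.v (y a) < 1 := fun a => by fin_cases a <;> assumption
      have hxi₀' : Valued.v (x i₀) < 1 := by
        rw [← hPy]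
        change Valued.v (∑ a, PM i₀ a * y a) < 1
        refine Valuation.map_sum_lt _ one_ne_zero fun a _ => ?_
        rw [map_mul]
        calc Valued.v (PM i₀ a) * Valued.v (y a) ≤ 1 * Valued.v (y a) := mul_le_mul' (hP i₀ a) le_rfl
          _ < 1 := by rw [one_mul]; exact hlt a
      exact absurd hxi₀ hxi₀'.ne
    -- STEP 4: `x = y₁ p₁ + r` with `r ∈ 𝔪³`, hence `N_x = N_{p₁}`
    obtain ⟨r, hr⟩ : ∃ r : Fin 3 → K, r = PM.mulVec (y - Pi.single 1 (y 1)) := ⟨_, rfl⟩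
    have hxdec : x = y 1 • p₁ + r := by
      rw [← hPy, hp₁, hr, ← Matrix.mulVec_smul, ← Matrix.mulVec_add]
      congr 1
      funext a
      rw [Pi.add_apply, Pi.smul_apply, Pi.sub_apply, smul_eq_mul]
      by_cases ha : a = 1
      · subst ha; rw [Pi.single_eq_same, Pi.single_eq_same]; ring
      · rw [Pi.single_eq_of_ne ha, Pi.single_eq_of_ne ha]; ring
    have hrlt : ∀ i, Valued.v (r i) < 1 := by
      intro i
      rw [hr]
      change Valued.v (∑ a, PM i a * (y - (Pi.single 1 (y 1) : Fin 3 → K)) a) < 1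
      refine Valuation.map_sum_lt _ one_ne_zero fun a _ => ?_
      rw [map_mul]
      have hsmall : Valued.v ((y - (Pi.single 1 (y 1) : Fin 3 → K)) a) < 1 := by
        rw [Pi.sub_apply]
        by_cases ha : a = 1
        · subst ha; rw [Pi.single_eq_same, sub_self, map_zero]; exact zero_lt_one
        · rw [Pi.single_eq_of_ne ha, sub_zero]
          fin_cases a
          · exact hy0
          · exact absurd rfl ha
          · exact hy2
      calc Valued.v (PM i a) * Valued.v ((y - (Pi.single 1 (y 1) : Fin 3 → K)) a) ≤ 1 * Valued.v ((y - (Pi.single 1 (y 1) : Fin 3 → K)) a) := mul_le_mul' (hP i a) le_rfl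
        _ < 1 := by rw [one_mul]; exact hsmall
    -- `|B₀ x y′ − σ(y₁) B₀ p₁ y′| < 1` for integral `y′`
    have hBx : ∀ y' : Fin 3 → K, y' ∈ stdLattice K 3 → Valued.v (B₀ σ 3 x y' - σ (y 1) * B₀ σ 3 p₁ y') < 1 := by
      intro y' hy'
      have e : B₀ σ 3 x y' - σ (y 1) * B₀ σ 3 p₁ y' = B₀ σ 3 r y' := by
        conv_lhs => rw [hxdec]
        rw [map_add, LinearMap.add_apply, LinearMap.map_smulₛₗ, LinearMap.smul_apply, smul_eq_mul]; ring
      rw [e, B₀_apply]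
      refine Valuation.map_sum_lt _ one_ne_zero fun a _ => ?_
      rw [map_mul, hd.vσ]
      calc Valued.v (r a) * Valued.v (y' (Fin.rev a)) ≤ Valued.v (r a) * 1 := mul_le_mul' le_rfl (hy' _)
        _ < 1 := by rw [mul_one]; exact hrlt a
    apply eq_of_forall_mem_iff
    intro y'
    rw [hW₁mem y', hw1]
    constructor
    · intro hy'
      have hy'L : y' ∈ stdLattice K 3 := (mapGL_N₁_le hκ hϖ1 hϖ0).2 hy'
      have hB : Valued.v (B₀ σ 3 x y') < 1 := by
        have h := (mem_mapGL_N₁_iff hκ hϖ0 hy'L).1 hy'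
        rw [← hx] at h
        exact (hlt1 _).2 h
      refine ⟨hy'L, ?_⟩
      have e : σ (y 1) * B₀ σ 3 p₁ y' = B₀ σ 3 x y' - (B₀ σ 3 x y' - σ (y 1) * B₀ σ 3 p₁ y') := by ring
      have h : Valued.v (σ (y 1) * B₀ σ 3 p₁ y') < 1 := by rw [e]; exact Valuation.map_sub_lt _ hB (hBx y' hy'L)
      rwa [map_mul, hd.vσ, hy1, one_mul] at h
    · rintro ⟨hy'L, hB⟩
      refine (mem_mapGL_N₁_iff hκ hϖ0 hy'L).2 ?_
      rw [← hx]
      refine (hlt1 _).1 ?_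
      have e : B₀ σ 3 x y' = (B₀ σ 3 x y' - σ (y 1) * B₀ σ 3 p₁ y') + σ (y 1) * B₀ σ 3 p₁ y' := by ring
      rw [e]
      refine Valuation.map_add_lt _ (hBx y' hy'L) ?_
      rw [map_mul, hd.vσ, hy1, one_mul]; exact hB
  -- the fixed set is the singleton `{W₁}`
  have hS : {w : {M : Submodule 𝒪[K] (Fin 3 → K) // IsVertex σ ϖ ((StdForm.antidiagonal 3).over K) M} |
      w ∈ (latticeGraph σ ϖ ((StdForm.antidiagonal 3).over K)).neighborSet ⟨stdLattice K 3, 0, isSelfDualLattice_stdLattice_three hd⟩ ∧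
        latticeGraphIso σ ϖ ((StdForm.antidiagonal 3).over K) k w = w} = {W₁} := by
    ext w
    simp only [Set.mem_setOf_eq, Set.mem_singleton_iff]
    exact ⟨fun h => huniq w h.1 h.2, fun h => by subst h; exact ⟨hW₁, hW₁fix⟩⟩
  rw [hS, Set.ncard_singleton]

end Summit.HodgeConjecture.HodgeConjecture.R90.S6

end
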